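import Summits.CriticalPhenomena.PercolationContinuityZ3.Theorems.PercNearOneGluingAdditiveGluingK0Set3
import HarnessLib

/-!
# Strict-compatibility RIGIDITY of the (S5) zero set for an ARBITRARY monotone functional

Support file (`--supports stmt-CriticalPhenomena-4575`), prover seat `prim-rate-mine-2` (lane prim-rate, constants-miner (c), BENCH row
M2-R31; `run/shared/lean/prim/prim-rate/prim-rate-mine-2/CANDIDATES.md` §gen-7, `PROOFS.md` §P30).  No definitions, no named facts, no sorries;
standard axioms.

The surplus-transfer inequality (S5) of the tree — `μ(v ↮ T, o ↔ v)·Sur_v(T)[F] ≤ μ(v ↮ T)·Sur_o(T)[F]` for EVERY weight vector, every monotone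
vertex-set functional `F` and every injective `∫F(C ·)`-compatible rank (`K0Set3.surplusTransfer_holds` = `CSH.surplusTransfer_of_nondegenerate` ∘
`CSH.s5dMargin_nonneg_of_csh` ∘ `CSH.cshAll`) — is LINEAR in `F` (`CSH.surplus_add`, `CSH.surplus_smul`), and STRICT compatibility of a rank
(`r a < r a' ⟹ m_a(F) < m_{a'}(F)`) is an OPEN condition: it survives the perturbation `F ↦ F + εG` for every monotone `G` and all small `ε > 0`
(`CSH.exists_pos_forall_compat_add_smul`).  Consequently:

* `CSH.surplusTransfer_of_eq_of_strictCompat` — **rigidity**: if (S5) is an EQUALITY for a monotone `F` at a strictly compatible injective rank `r`,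
  then (S5) holds AT THE SAME RANK `r` for EVERY monotone `G`, compatible with `r` or not;
* `CSH.s5dMargin_nil_nonneg_of_eq_zero_of_strictCompat` — margin form: `s5dMargin w T r [] o v F = 0 ⟹ 0 ≤ s5dMargin w T r [] o v G` (when `μ(v ↮ T) > 0`);
* `CSH.s5dMargin_nil_pos_of_strictCompat_of_neg` — the contrapositive as a ONE-FUNCTIONAL STRICTNESS CERTIFICATE: a monotone `G` with
  `s5dMargin w T r [] o v G < 0` certifies `0 < s5dMargin w T r [] o v F` simultaneously for every monotone `F` strictly `r`-compatible;
* `CSH.s5dMargin_nil_eq_zero_of_absorbed` — if moreover `F − ε•G` is monotone for some `ε > 0` then `G` is a zero too; in particular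
  `CSH.s5dMargin_nil_levelSet_eq_zero` — **every level set `1{t ≤ F}` of a strictly compatible zero `F` is a zero** (its indicator need not be
  `r`-compatible).

So, for strictly compatible data, whether a monotone `F` is an equality case of (S5) is decided by the rank tuple `(T, o, v, r)` up to the
requirement that the (S5) functional be nonnegative on the whole monotone cone at `r`; only TIES escape (BENCH row M2-R22-NEG-TIE is the escape).
[cite: KozmaNitzan2024, Conj. 4 (p. 32)] [cite: VandenbergHaggstromKahn2005, Thm. 1.3 (p. 6)]
-/

noncomputable section

namespace Summit.CriticalPhenomena.PercolationContinuityZ3.Theorems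

open MeasureTheory Set Filter Topology Literature.Probability.LatticeModels Literature.Probability.Percolation
open scoped Classical

namespace CSH

variable {n : ℕ}

/-! ### Linearity of the ranked surplus in the functional -/

/-- `Sur_u(T)[F + G] = Sur_u(T)[F] + Sur_u(T)[G]`. [cite: KozmaNitzan2024, Conj. 4 (p. 32)] -/
theorem surplus_add (w : Sym2 (Fin n) → unitInterval) (T : Finset (Fin n)) (r : Fin n → ℕ) (F G : Set (Fin n) → ℝ) (u : Fin n) :
    surplus w T r (F + G) u = surplus w T r F u + surplus w T r G u := by
  have hint : ∀ (g : BondConfig (Fin n) → ℝ) (ν : Measure (BondConfig (Fin n))) [IsFiniteMeasure ν], Integrable g ν :=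
    fun g ν _ => Integrable.of_finite
  have h1 : ∀ (ν : Measure (BondConfig (Fin n))) [IsFiniteMeasure ν] (x : Fin n),
      ∫ ω, (F + G) (openCluster ω x) ∂ν = (∫ ω, F (openCluster ω x) ∂ν) + ∫ ω, G (openCluster ω x) ∂ν := by
    intro ν _ x
    simp only [Pi.add_apply]
    exact integral_add (hint _ _) (hint _ _)
  have h2 : ∀ x : Fin n, ∫ ω, (F + G) (openCluster ω x) ∂(prodBernoulli w) =
      (∫ ω, F (openCluster ω x) ∂(prodBernoulli w)) + ∫ ω, G (openCluster ω x) ∂(prodBernoulli w) := fun x => h1 _ x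
  unfold surplus
  rw [h1]
  simp only [h2, mul_add, Finset.sum_add_distrib]
  ring

/-- `Sur_u(T)[c • F] = c · Sur_u(T)[F]`. [cite: KozmaNitzan2024, Conj. 4 (p. 32)] -/
theorem surplus_smul (w : Sym2 (Fin n) → unitInterval) (T : Finset (Fin n)) (r : Fin n → ℕ) (c : ℝ) (F : Set (Fin n) → ℝ) (u : Fin n) :
    surplus w T r (c • F) u = c * surplus w T r F u := by
  unfold surplus
  simp only [Pi.smul_apply, smul_eq_mul, integral_const_mul]
  rw [mul_sub, Finset.mul_sum]
  congr 1
  exact Finset.sum_congr rfl fun x _ => by ring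

/-- The mean of `(F + ε • G)(C_a)` is `m_a(F) + ε · m_a(G)`. [folklore] -/
theorem integral_add_smul_openCluster (w : Sym2 (Fin n) → unitInterval) (F G : Set (Fin n) → ℝ) (ε : ℝ) (a : Fin n) :
    ∫ ω, (F + ε • G) (openCluster ω a) ∂(prodBernoulli w) =
      (∫ ω, F (openCluster ω a) ∂(prodBernoulli w)) + ε * ∫ ω, G (openCluster ω a) ∂(prodBernoulli w) := by
  have hint : ∀ (g : BondConfig (Fin n) → ℝ), Integrable g (prodBernoulli w) := fun g => Integrable.of_finite
  simp only [Pi.add_apply, Pi.smul_apply, smul_eq_mul]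
  rw [integral_add (hint _) (hint _), integral_const_mul]

/-! ### Strict compatibility is open under monotone perturbations -/

/-- **Openness of strict compatibility.**  If `r a < r a' ⟹ m_a(F) < m_{a'}(F)` on the finite relay set `T`, then for some `ε > 0` the rank `r`
is still compatible with the means of `F + ε • G` (any `G`). [folklore] -/
theorem exists_pos_forall_compat_add_smul (w : Sym2 (Fin n) → unitInterval) (T : Finset (Fin n)) (r : Fin n → ℕ)
    (F G : Set (Fin n) → ℝ)
    (hstrict : ∀ a ∈ T, ∀ a' ∈ T, r a < r a' →
      ∫ ω, F (openCluster ω a) ∂(prodBernoulli w) < ∫ ω, F (openCluster ω a') ∂(prodBernoulli w)) :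
    ∃ ε : ℝ, 0 < ε ∧ ∀ a ∈ T, ∀ a' ∈ T, r a < r a' →
      ∫ ω, (F + ε • G) (openCluster ω a) ∂(prodBernoulli w) ≤ ∫ ω, (F + ε • G) (openCluster ω a') ∂(prodBernoulli w) := by
  set mF : Fin n → ℝ := fun a => ∫ ω, F (openCluster ω a) ∂(prodBernoulli w) with hmF
  set mG : Fin n → ℝ := fun a => ∫ ω, G (openCluster ω a) ∂(prodBernoulli w) with hmG
  -- each ordered pair gives an `eventually` condition at `0⁺`; finitely many pairs
  have hpair : ∀ p ∈ T ×ˢ T, ∀ᶠ ε in 𝓝[>] (0 : ℝ), r p.1 < r p.2 → mF p.1 + ε * mG p.1 ≤ mF p.2 + ε * mG p.2 := by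
    intro p hp
    by_cases hlt : r p.1 < r p.2
    · have hgap : 0 < (mF p.2 - mF p.1) + 0 * (mG p.2 - mG p.1) := by
        have := hstrict p.1 (Finset.mem_product.1 hp).1 p.2 (Finset.mem_product.1 hp).2 hlt
        simp only [zero_mul, add_zero, sub_pos]
        exact this
      have hcont : Tendsto (fun ε : ℝ => (mF p.2 - mF p.1) + ε * (mG p.2 - mG p.1)) (𝓝[>] (0 : ℝ))
          (𝓝 ((mF p.2 - mF p.1) + 0 * (mG p.2 - mG p.1))) := by
        have h : Continuous (fun ε : ℝ => (mF p.2 - mF p.1) + ε * (mG p.2 - mG p.1)) := by continuity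
        exact (h.tendsto 0).mono_left nhdsWithin_le_nhds
      filter_upwards [hcont.eventually (lt_mem_nhds hgap)] with ε hε _
      linarith
    · exact Eventually.of_forall fun ε h => absurd h hlt
  have hall : ∀ᶠ ε in 𝓝[>] (0 : ℝ), ∀ p ∈ T ×ˢ T, r p.1 < r p.2 → mF p.1 + ε * mG p.1 ≤ mF p.2 + ε * mG p.2 :=
    (Finset.eventually_all (T ×ˢ T)).2 hpair
  have hpos : ∀ᶠ ε in 𝓝[>] (0 : ℝ), 0 < ε := eventually_mem_nhdsWithin
  obtain ⟨ε, hεpos, hε⟩ := (hpos.and hall).exists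
  refine ⟨ε, hεpos, fun a ha a' ha' hlt => ?_⟩
  rw [integral_add_smul_openCluster, integral_add_smul_openCluster]
  exact hε (a, a') (Finset.mem_product.2 ⟨ha, ha'⟩) hlt

/-! ### Rigidity -/

/-- **RIGIDITY of the (S5) zero set under strict compatibility.**  Any weights; `v ∉ T`; `F`, `G` monotone vertex-set functionals; `r` injective
on `T` and STRICTLY compatible with the means of `F`.  If the surplus transfer is an EQUALITY for `F`,
`μ(v ↮ T, o ↔ v)·Sur_v(T)[F] = μ(v ↮ T)·Sur_o(T)[F]`, then it holds for `G` at the same rank `r` (no compatibility asked of `G`):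
`μ(v ↮ T, o ↔ v)·Sur_v(T)[G] ≤ μ(v ↮ T)·Sur_o(T)[G]`.  Proof: (S5) for `F + ε • G` (monotone, strictly `r`-compatible for small `ε > 0`),
linearity, subtract the equality, divide by `ε`. [cite: KozmaNitzan2024, Conj. 4 (p. 32)] -/
theorem surplusTransfer_of_eq_of_strictCompat (w : Sym2 (Fin n) → unitInterval) (T : Finset (Fin n)) (o v : Fin n)
    (F G : Set (Fin n) → ℝ) (r : Fin n → ℕ) (hvT : v ∉ T)
    (hF : ∀ S S' : Set (Fin n), S ⊆ S' → F S ≤ F S') (hG : ∀ S S' : Set (Fin n), S ⊆ S' → G S ≤ G S')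
    (hr : Set.InjOn r ↑T)
    (hstrict : ∀ a ∈ T, ∀ a' ∈ T, r a < r a' →
      ∫ ω, F (openCluster ω a) ∂(prodBernoulli w) < ∫ ω, F (openCluster ω a') ∂(prodBernoulli w))
    (heq : (prodBernoulli w).real ({ω : BondConfig (Fin n) | ∀ a ∈ T, ¬ (openGraph ω).Reachable v a} ∩ openConn o v) * surplus w T r F v =
      (prodBernoulli w).real {ω : BondConfig (Fin n) | ∀ a ∈ T, ¬ (openGraph ω).Reachable v a} * surplus w T r F o) :
    (prodBernoulli w).real ({ω : BondConfig (Fin n) | ∀ a ∈ T, ¬ (openGraph ω).Reachable v a} ∩ openConn o v) * surplus w T r G v ≤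
      (prodBernoulli w).real {ω : BondConfig (Fin n) | ∀ a ∈ T, ¬ (openGraph ω).Reachable v a} * surplus w T r G o := by
  obtain ⟨ε, hε, hcompat⟩ := exists_pos_forall_compat_add_smul w T r F G hstrict
  have hmono : ∀ S S' : Set (Fin n), S ⊆ S' → (F + ε • G) S ≤ (F + ε • G) S' := by
    intro S S' hSS'
    simp only [Pi.add_apply, Pi.smul_apply, smul_eq_mul]
    have h1 := hF S S' hSS'
    have h2 := hG S S' hSS'
    nlinarith
  have key := Cruxes.AdditiveGluing.TieLine.K0Set3.surplusTransfer_holds w T o v (F + ε • G) r hvT hmono hr hcompat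
  rw [surplus_add, surplus_add, surplus_smul, surplus_smul] at key
  set μ1 := (prodBernoulli w).real ({ω : BondConfig (Fin n) | ∀ a ∈ T, ¬ (openGraph ω).Reachable v a} ∩ openConn o v)
  set μ0 := (prodBernoulli w).real {ω : BondConfig (Fin n) | ∀ a ∈ T, ¬ (openGraph ω).Reachable v a}
  have h1 : ε * (μ1 * surplus w T r G v) ≤ ε * (μ0 * surplus w T r G o) := by nlinarith [key, heq]
  exact le_of_mul_le_mul_left h1 hε

/-- (S5) in margin form, all weights: if `μ(v ↮ T) > 0` then `0 ≤ s5dMargin w T r [] o v F` for monotone `F` and an injective compatible rank.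
[cite: KozmaNitzan2024, Conj. 4 (p. 32)] -/
theorem s5dMargin_nil_nonneg_of_compat (w : Sym2 (Fin n) → unitInterval) (T : Finset (Fin n)) (o v : Fin n)
    (F : Set (Fin n) → ℝ) (r : Fin n → ℕ) (hvT : v ∉ T)
    (hF : ∀ S S' : Set (Fin n), S ⊆ S' → F S ≤ F S') (hr : Set.InjOn r ↑T)
    (hcompat : ∀ a ∈ T, ∀ a' ∈ T, r a < r a' →
      ∫ ω, F (openCluster ω a) ∂(prodBernoulli w) ≤ ∫ ω, F (openCluster ω a') ∂(prodBernoulli w))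
    (hpos : 0 < (prodBernoulli w).real {ω : BondConfig (Fin n) | ∀ a ∈ T, ¬ (openGraph ω).Reachable v a}) :
    0 ≤ s5dMargin w T r [] o v F := by
  have key := Cruxes.AdditiveGluing.TieLine.K0Set3.surplusTransfer_holds w T o v F r hvT hF hr hcompat
  rw [s5dMargin_nil]
  simp only [Finset.mem_coe]
  rw [sub_nonneg, div_mul_eq_mul_div]
  exact (div_le_iff₀ hpos).2 (by linarith)

/-- **Rigidity, margin form.**  Any weights with `μ(v ↮ T) > 0` (e.g. all `w < 1`); `v ∉ T`; `F`, `G` monotone; `r` injective and strictly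
`m(F)`-compatible.  If `s5dMargin w T r [] o v F = 0` then `0 ≤ s5dMargin w T r [] o v G` — the (S5) functional is nonnegative on the WHOLE
monotone cone at the rank `r`. [cite: KozmaNitzan2024, Conj. 4 (p. 32)] -/
theorem s5dMargin_nil_nonneg_of_eq_zero_of_strictCompat (w : Sym2 (Fin n) → unitInterval) (T : Finset (Fin n)) (o v : Fin n)
    (F G : Set (Fin n) → ℝ) (r : Fin n → ℕ) (hvT : v ∉ T)
    (hF : ∀ S S' : Set (Fin n), S ⊆ S' → F S ≤ F S') (hG : ∀ S S' : Set (Fin n), S ⊆ S' → G S ≤ G S')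
    (hr : Set.InjOn r ↑T)
    (hstrict : ∀ a ∈ T, ∀ a' ∈ T, r a < r a' →
      ∫ ω, F (openCluster ω a) ∂(prodBernoulli w) < ∫ ω, F (openCluster ω a') ∂(prodBernoulli w))
    (hpos : 0 < (prodBernoulli w).real {ω : BondConfig (Fin n) | ∀ a ∈ T, ¬ (openGraph ω).Reachable v a})
    (h0 : s5dMargin w T r [] o v F = 0) :
    0 ≤ s5dMargin w T r [] o v G := by
  rw [s5dMargin_nil] at h0
  simp only [Finset.mem_coe] at h0
  set μ1 := (prodBernoulli w).real ({ω : BondConfig (Fin n) | ∀ a ∈ T, ¬ (openGraph ω).Reachable v a} ∩ openConn o v) with hμ1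
  set μ0 := (prodBernoulli w).real {ω : BondConfig (Fin n) | ∀ a ∈ T, ¬ (openGraph ω).Reachable v a} with hμ0
  have h0' : μ1 * surplus w T r F v = μ0 * surplus w T r F o := by
    have : surplus w T r F o = μ1 / μ0 * surplus w T r F v := by linarith
    rw [this]
    field_simp
  have key := surplusTransfer_of_eq_of_strictCompat w T o v F G r hvT hF hG hr hstrict h0'
  rw [s5dMargin_nil]
  simp only [Finset.mem_coe]
  rw [sub_nonneg, div_mul_eq_mul_div]
  exact (div_le_iff₀ hpos).2 (by linarith)

/-- **One-functional strictness certificate.**  Any weights with `μ(v ↮ T) > 0`; `v ∉ T`; `r` injective on `T`.  If SOME monotone `G` has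
`s5dMargin w T r [] o v G < 0`, then `0 < s5dMargin w T r [] o v F` for EVERY monotone `F` with which `r` is strictly compatible.
[cite: KozmaNitzan2024, Conj. 4 (p. 32)] -/
theorem s5dMargin_nil_pos_of_strictCompat_of_neg (w : Sym2 (Fin n) → unitInterval) (T : Finset (Fin n)) (o v : Fin n)
    (F G : Set (Fin n) → ℝ) (r : Fin n → ℕ) (hvT : v ∉ T)
    (hF : ∀ S S' : Set (Fin n), S ⊆ S' → F S ≤ F S') (hG : ∀ S S' : Set (Fin n), S ⊆ S' → G S ≤ G S')
    (hr : Set.InjOn r ↑T)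
    (hstrict : ∀ a ∈ T, ∀ a' ∈ T, r a < r a' →
      ∫ ω, F (openCluster ω a) ∂(prodBernoulli w) < ∫ ω, F (openCluster ω a') ∂(prodBernoulli w))
    (hpos : 0 < (prodBernoulli w).real {ω : BondConfig (Fin n) | ∀ a ∈ T, ¬ (openGraph ω).Reachable v a})
    (hneg : s5dMargin w T r [] o v G < 0) :
    0 < s5dMargin w T r [] o v F := by
  have hnn := s5dMargin_nil_nonneg_of_compat w T o v F r hvT hF hr (fun a ha a' ha' h => (hstrict a ha a' ha' h).le) hpos
  rcases hnn.lt_or_eq with h | h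
  · exact h
  · exact absurd (s5dMargin_nil_nonneg_of_eq_zero_of_strictCompat w T o v F G r hvT hF hG hr hstrict hpos h.symm) (not_le.2 hneg)

/-- **Rigidity of the (GEN) zero set.**  Any weights, any observer `o`; `F`, `G` monotone and nonnegative; `r` injective on `A` and strictly
`m(F)`-compatible.  If the master form (GEN) is an equality for `F`, `Sur_o(A)[F] = 0`, then `0 ≤ Sur_o(A)[G]` — (GEN) holds for `G` at the rank `r`
whether or not `r` is compatible with `G` (tree (GEN) = `EventGluingSharp.gen_holds`, applied to `F + ε • G`). [cite: KozmaNitzan2024, Conj. 4 (p. 32)]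
[cite: VandenbergHaggstromKahn2005, Thm. 1.3 (p. 6)] -/
theorem surplus_nonneg_of_eq_zero_of_strictCompat (w : Sym2 (Fin n) → unitInterval) (A : Finset (Fin n)) (o : Fin n)
    (F G : Set (Fin n) → ℝ) (r : Fin n → ℕ)
    (hF : ∀ S S' : Set (Fin n), S ⊆ S' → F S ≤ F S') (hF0 : ∀ S, 0 ≤ F S)
    (hG : ∀ S S' : Set (Fin n), S ⊆ S' → G S ≤ G S') (hG0 : ∀ S, 0 ≤ G S)
    (hr : Set.InjOn r ↑A)
    (hstrict : ∀ a ∈ A, ∀ a' ∈ A, r a < r a' →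
      ∫ ω, F (openCluster ω a) ∂(prodBernoulli w) < ∫ ω, F (openCluster ω a') ∂(prodBernoulli w))
    (h0 : surplus w A r F o = 0) :
    0 ≤ surplus w A r G o := by
  obtain ⟨ε, hε, hcompat⟩ := exists_pos_forall_compat_add_smul w A r F G hstrict
  have hmono : ∀ S S' : Set (Fin n), S ⊆ S' → (F + ε • G) S ≤ (F + ε • G) S' := by
    intro S S' hSS'
    simp only [Pi.add_apply, Pi.smul_apply, smul_eq_mul]
    have h1 := hF S S' hSS'
    have h2 := hG S S' hSS'
    nlinarith
  have hnn : ∀ S, 0 ≤ (F + ε • G) S := fun S => by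
    simp only [Pi.add_apply, Pi.smul_apply, smul_eq_mul]
    nlinarith [hF0 S, hG0 S]
  have key := EventGluingSharp.gen_holds n w A o (F + ε • G) r hmono hnn hr hcompat
  have key' : 0 ≤ surplus w A r (F + ε • G) o := by
    unfold surplus
    linarith
  rw [surplus_add, surplus_smul, h0, zero_add] at key'
  nlinarith [key', hε]

/-- **One-functional strictness certificate for (GEN).**  Any weights; `F`, `G` monotone nonnegative; `r` injective and strictly `m(F)`-compatible.
If `Sur_o(A)[G] < 0` then `0 < Sur_o(A)[F]`. [cite: KozmaNitzan2024, Conj. 4 (p. 32)] -/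
theorem surplus_pos_of_strictCompat_of_neg (w : Sym2 (Fin n) → unitInterval) (A : Finset (Fin n)) (o : Fin n)
    (F G : Set (Fin n) → ℝ) (r : Fin n → ℕ)
    (hF : ∀ S S' : Set (Fin n), S ⊆ S' → F S ≤ F S') (hF0 : ∀ S, 0 ≤ F S)
    (hG : ∀ S S' : Set (Fin n), S ⊆ S' → G S ≤ G S') (hG0 : ∀ S, 0 ≤ G S)
    (hr : Set.InjOn r ↑A)
    (hstrict : ∀ a ∈ A, ∀ a' ∈ A, r a < r a' →
      ∫ ω, F (openCluster ω a) ∂(prodBernoulli w) < ∫ ω, F (openCluster ω a') ∂(prodBernoulli w))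
    (hneg : surplus w A r G o < 0) :
    0 < surplus w A r F o := by
  have key := EventGluingSharp.gen_holds n w A o F r hF hF0 hr (fun a ha a' ha' h => (hstrict a ha a' ha' h).le)
  have hnn : 0 ≤ surplus w A r F o := by
    unfold surplus
    linarith
  rcases hnn.lt_or_eq with h | h
  · exact h
  · exact absurd (surplus_nonneg_of_eq_zero_of_strictCompat w A o F G r hF hF0 hG hG0 hr hstrict h.symm) (not_le.2 hneg)

/-- The decoy-free margin is linear in the functional: `margin[F + c • G] = margin[F] + c · margin[G]`. [cite: KozmaNitzan2024, Conj. 4 (p. 32)] -/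
theorem s5dMargin_nil_add_smul (w : Sym2 (Fin n) → unitInterval) (T : Finset (Fin n)) (r : Fin n → ℕ) (o v : Fin n)
    (F G : Set (Fin n) → ℝ) (c : ℝ) :
    s5dMargin w T r [] o v (F + c • G) = s5dMargin w T r [] o v F + c * s5dMargin w T r [] o v G := by
  rw [s5dMargin_nil, s5dMargin_nil, s5dMargin_nil, surplus_add, surplus_add, surplus_smul, surplus_smul]
  ring

/-- **Absorption.**  At a strictly compatible zero `F` of (S5) (any weights with `μ(v ↮ T) > 0`), every monotone `G` such that `F − ε • G` is
still monotone for some `ε > 0` is a zero as well: `s5dMargin w T r [] o v G = 0`. [cite: KozmaNitzan2024, Conj. 4 (p. 32)] -/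
theorem s5dMargin_nil_eq_zero_of_absorbed (w : Sym2 (Fin n) → unitInterval) (T : Finset (Fin n)) (o v : Fin n)
    (F G : Set (Fin n) → ℝ) (r : Fin n → ℕ) (ε : ℝ) (hvT : v ∉ T)
    (hF : ∀ S S' : Set (Fin n), S ⊆ S' → F S ≤ F S') (hG : ∀ S S' : Set (Fin n), S ⊆ S' → G S ≤ G S')
    (hε : 0 < ε) (hFG : ∀ S S' : Set (Fin n), S ⊆ S' → (F - ε • G) S ≤ (F - ε • G) S')
    (hr : Set.InjOn r ↑T)
    (hstrict : ∀ a ∈ T, ∀ a' ∈ T, r a < r a' →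
      ∫ ω, F (openCluster ω a) ∂(prodBernoulli w) < ∫ ω, F (openCluster ω a') ∂(prodBernoulli w))
    (hpos : 0 < (prodBernoulli w).real {ω : BondConfig (Fin n) | ∀ a ∈ T, ¬ (openGraph ω).Reachable v a})
    (h0 : s5dMargin w T r [] o v F = 0) :
    s5dMargin w T r [] o v G = 0 := by
  have h1 := s5dMargin_nil_nonneg_of_eq_zero_of_strictCompat w T o v F G r hvT hF hG hr hstrict hpos h0
  have h2 := s5dMargin_nil_nonneg_of_eq_zero_of_strictCompat w T o v F (F - ε • G) r hvT hF hFG hr hstrict hpos h0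
  have h3 : s5dMargin w T r [] o v (F - ε • G) = s5dMargin w T r [] o v F + (-ε) * s5dMargin w T r [] o v G := by
    rw [← s5dMargin_nil_add_smul]
    congr 1
    ext S
    simp only [Pi.sub_apply, Pi.add_apply, Pi.smul_apply, smul_eq_mul, neg_mul]
    ring
  rw [h3, h0] at h2
  nlinarith

/-- **Every level set of a strictly compatible zero is a zero.**  Any weights with `μ(v ↮ T) > 0`; `v ∉ T`; `F` monotone; `r` injective and
strictly `m(F)`-compatible; `s5dMargin w T r [] o v F = 0`.  Then for every threshold `t` the up-set indicator `1{t ≤ F(·)}` has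
`s5dMargin w T r [] o v 1{t ≤ F(·)} = 0` (although `r` need not be compatible with ITS means). [cite: KozmaNitzan2024, Conj. 4 (p. 32)] -/
theorem s5dMargin_nil_levelSet_eq_zero (w : Sym2 (Fin n) → unitInterval) (T : Finset (Fin n)) (o v : Fin n)
    (F : Set (Fin n) → ℝ) (r : Fin n → ℕ) (t : ℝ) (hvT : v ∉ T)
    (hF : ∀ S S' : Set (Fin n), S ⊆ S' → F S ≤ F S') (hr : Set.InjOn r ↑T)
    (hstrict : ∀ a ∈ T, ∀ a' ∈ T, r a < r a' →
      ∫ ω, F (openCluster ω a) ∂(prodBernoulli w) < ∫ ω, F (openCluster ω a') ∂(prodBernoulli w))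
    (hpos : 0 < (prodBernoulli w).real {ω : BondConfig (Fin n) | ∀ a ∈ T, ¬ (openGraph ω).Reachable v a})
    (h0 : s5dMargin w T r [] o v F = 0) :
    s5dMargin w T r [] o v (fun S : Set (Fin n) => if t ≤ F S then (1 : ℝ) else 0) = 0 := by
  set G : Set (Fin n) → ℝ := fun S => if t ≤ F S then (1 : ℝ) else 0 with hGdef
  have hG : ∀ S S' : Set (Fin n), S ⊆ S' → G S ≤ G S' := by
    intro S S' hSS'
    simp only [hGdef]
    by_cases h : t ≤ F S
    · rw [if_pos h, if_pos (h.trans (hF S S' hSS'))]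
    · rw [if_neg h]; split_ifs <;> norm_num
  -- a positive gap `ε` below the threshold: `F S < t ⟹ F S ≤ t - ε`
  obtain ⟨ε, hε, hgap⟩ : ∃ ε : ℝ, 0 < ε ∧ ∀ S : Set (Fin n), F S < t → F S ≤ t - ε := by
    by_cases hne : ((Finset.univ : Finset (Set (Fin n))).filter (fun S => F S < t)).Nonempty
    · obtain ⟨S₀, hS₀, hmax⟩ := Finset.exists_max_image _ F hne
      have hS₀t : F S₀ < t := (Finset.mem_filter.1 hS₀).2
      refine ⟨t - F S₀, by linarith, fun S hS => ?_⟩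
      have := hmax S (Finset.mem_filter.2 ⟨Finset.mem_univ _, hS⟩)
      linarith
    · refine ⟨1, one_pos, fun S hS => ?_⟩
      exact absurd ⟨S, Finset.mem_filter.2 ⟨Finset.mem_univ _, hS⟩⟩ hne
  have hFG : ∀ S S' : Set (Fin n), S ⊆ S' → (F - ε • G) S ≤ (F - ε • G) S' := by
    intro S S' hSS'
    have hm := hF S S' hSS'
    simp only [Pi.sub_apply, Pi.smul_apply, smul_eq_mul, hGdef]
    by_cases h : t ≤ F S
    · rw [if_pos h, if_pos (h.trans hm)]; linarith
    · rw [if_neg h]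
      by_cases h' : t ≤ F S'
      · rw [if_pos h']
        have := hgap S (not_le.1 h)
        linarith
      · rw [if_neg h']; linarith
  exact s5dMargin_nil_eq_zero_of_absorbed w T o v F G r ε hvT hF hG hε hFG hr hstrict hpos h0

end CSH

end Summit.CriticalPhenomena.PercolationContinuityZ3.Theorems

end
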